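import Mathlib
import Summits.NavierStokesRegularity.NavierStokesRegularity.Theorems.TaoLadderRungTwoFlatHopTubeWithGlue
import HarnessLib

/-!
# CORE CONTRACT 62 — the typed contract between the JOINT SCHEDULE (§61/§62, kernel-checked rational rows) and the
  CORE LANDING (P-62a + DEFECT-62, the analytic half), stated over the parametric hop tube of record
  (`HopTube.HopPremiseWith` / `TubeStepCoreWith`, choice rule `choiceRule … good`)
  (cell harvest/h2-tao-ladder, theory-1 g48, numT62 addendum; helper design for the K_A♭ parent item
  stmt-NavierStokesRegularity-22987 `FlatGapCertificatesV2`, child 2A `GradedAdiabaticWake`; referee W-28 «core-clause contract»)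

WHAT THIS FILE FIXES (shape only; every bound is a HYPOTHESIS).
* `anchoredDev P i₀ u⋆ S t i k := S i (1+k) t − (|S i₀ 1 t| / A_*) · u⋆ i k` — the deviation of the flow at time `t`, read one
  shell up, from the member of the pulse family selected by the flow's OWN head carrier (the anchored comparison: the
  mismatch along the neutral scaling direction is ZERO by construction — this is numT56 L-56b's sharp anchor read-off
  (`core_landing_at_section_time_sharp` with `κ :=` the own head ratio, `E_a = 0`, `h = 0`), NOT the unsharp
  `core_landing_at_section_time`, whose budget `η₁ + (η₁/ω₀/A_*)·M_ω ≥ 2η₁` (`M_ω ≥ ω₀A_*` from the head row) would need a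
  one-hop factor `< ρ/2` — cured in §56 (L2), recalled here only so that P-62a is never keyed to the unsharp lemma).
* `CoreLandingWith … n lev B` — THE CONTRACT: for every premise flow of hop `n` and every good section time `t`, IF the
  interface-shell deviation from the comparison flow `W` stays under the levels `lev i` on `[0, t]` (the loop's certified
  interface data, §61), THEN the anchored deviation at `t` is at most `B` in the `(g, b)` gauge on `k ≥ −K` (un-normalised).
* `tubeStepCoreWith_of_landing` — **contract + interface levels + ratio floor `AFL ≤ a` + the schedule row `B ≤ AFL · δ(n+1)`
  ⇒ `TubeStepCoreWith` for the choice rule** (kernel-checked; the division by the clamped ratio `a` is exact).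
* `LandingLevel` and `tubeStepCoreWith_of_landing_row` — the same with `B` in the P-62a shape
  `RHOC·(δ n + KI) + (KF 0·lev 0 + KF 1·lev 1) + KQ·(δ n + KI)² + DJ` (one-hop anchored factor `RHOC`, kick allowance `KI`,
  interface forcing constants `KF`, quadratic remainder `KQ`, reference defect `DJ` of R53-1), so that the schedule hypothesis is
  LITERALLY the certificate conjunct `hcoreland` (Row.OK: `RHOC·DCORE + BK·(KFV·BBARA + KFA·RBARA) + KQ8·DCORE² + DJ8 ≤ AFL·DCn`
  up to the kick allowance).
* `kick_core_le` — the kick allowance: `geomGauge ≤ KIW · w` on `k ≥ −K` and the premise's kick ball give the core-gauge size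
  `KIW · r` of the kick (so `KI := KIW · r`; for the tube weight `tubeWeight C b`, `C ≥ 1`, `b ≥ 1/2`, and the gauge `(4,2)`:
  `KIW = sup_k 4^{k⁺}2^{−k⁻}/w_k ≤ 2`, attained at `k ∈ {1,2}` when `b = 1/2`).
* `one_sub_mul_le_rpow_neg`, `one_sub_mul_le_clampedRatio` — the exact rational ratio floor `AFL := 1 − θ₀ε₀ ≤ (1+ε₀)^(−θ₀) ≤ a`
  (Bernoulli), which discharges `hratio` unconditionally (desk: `99975/100000` at `θ₀ = 1/4`, `ε₀ = 10⁻³`).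

HONEST FRAMING: MODEL lattice (Tao 2016 §4–§6 vocabulary on the shift sets); the contract is a DEFINITION and the theorems are
bookkeeping (division by the ratio, `le_trans`); the landing itself (discharging `CoreLandingWith` by linearisation at the
pre-iterate reference + an interval enclosure of the anchored fundamental matrix + the quadratic remainder + the reference defect)
is NOT done here; desk floats for the constants are in numT62 (RHOC 0.609 → 5/8, KFV 4.8e-4 → 1/1000, KFA = 0, KQ = 8·KQ8 = 20 ≥ 2.0
measured, DJ per DEFECT-62); nothing certified; no item closed; nothing about the Navier–Stokes equations.
-/

noncomputable section

-- the sub-problem namespace repeats the summit name by design (D-0017)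
set_option linter.dupNamespace false

namespace Summit.NavierStokesRegularity.NavierStokesRegularity.Theorems.HopTube

open Set Finset Literature.Analysis.FluidPDE Literature.Analysis.FluidPDE.TaoCascade MirrorPulse

/-- The ANCHORED deviation of a flow `S` at time `t`, read one shell up (the hop's index shift), from the pulse member selected by
the flow's own head carrier `|S i₀ 1 t| / A_*` (`u⋆` normalised to `|u⋆ i₀ 0| = A_*`).
[cite: Tao2016AveragedNS, §6.3 (modulation along the scaling direction, statement shape); cell LADDER §62 (P-62a, scale anchor P_a)] -/
def anchoredDev (P : TubeSchedule) (i₀ : Fin 2) (ustar : Fin 2 → ℤ → ℝ) (S : Fin 2 → ℤ → ℝ → ℝ) (t : ℝ)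
    (i : Fin 2) (k : ℤ) : ℝ :=
  S i (1 + k) t - |S i₀ 1 t| / P.Astar * ustar i k

/-- The P-62a landing level: one-hop anchored factor `RHOC` acting on the input radius `δ n + KI` (core radius + kick allowance),
interface forcing `KF i · lev i` (carrier / bond species at the interface shell), quadratic remainder `KQ`, reference defect `DJ`.
[cite: Tao2016AveragedNS, §6.4 (statement shape of the checkpoint step); cell LADDER §62 (P-62a), DEFECT-62 (+D_J)] -/
def LandingLevel (RHOC KQ DJ KI δn : ℝ) (KF lev : Fin 2 → ℝ) : ℝ :=
  RHOC * (δn + KI) + (KF 0 * lev 0 + KF 1 * lev 1) + KQ * (δn + KI) ^ 2 + DJ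

section Contract

variable (P : TubeSchedule) (Bcl : ℕ → (Fin 2 → ℤ → ℝ) → Prop) (𝕊 : Finset (ℤ × ℤ × ℤ)) (ε₀ : ℝ) (i₀ : Fin 2)
  (α : Fin 2 → Fin 2 → Fin 2 → ℤ × ℤ × ℤ → ℝ) (X₀ : Fin 2 → ℝ) (w : ℤ → ℝ) (r c₀ : ℝ)
  (ζ : ℕ → Fin 2 → ℤ → ℝ) (ustar : Fin 2 → ℤ → ℝ) (good : ℕ → (Fin 2 → ℤ → ℝ → ℝ) → ℝ → Prop)
  (W : Fin 2 → ℤ → ℝ → ℝ)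

/-- **THE CORE LANDING CONTRACT at hop `n`** (analytic half of P-62a; to be discharged by linearisation at the pre-iterate reference,
an interval enclosure of the anchored one-hop fundamental matrix, the quadratic remainder and the reference defect): for every premise
flow `S` of hop `n` and every good section time `t`, if the interface-shell deviation from the comparison flow `W` stays under the
levels `lev i` on `[0, t]`, the anchored deviation at `t` is at most `B` in the `(g,b)` gauge on `k ≥ −K`.
[cite: Tao2016AveragedNS, §6.3–6.4 (statement shape); cell LADDER §61 (interface loop), §62 (P-62a), DEFECT-62] -/
def CoreLandingWith (n : ℕ) (lev : Fin 2 → ℝ) (B : ℝ) : Prop :=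
  ∀ z S₀ τ S F, HopPremiseWith P Bcl 𝕊 ε₀ i₀ α X₀ w r c₀ ζ ustar n z S₀ τ S F → ∀ t, good n S t →
    (∀ s ∈ Icc 0 t, ∀ i, |(S - W) i (1 - (P.K : ℤ)) s| ≤ lev i) →
      ∀ (i : Fin 2) (k : ℤ), -(P.K : ℤ) ≤ k →
        geomGauge P.g P.b i k * |anchoredDev P i₀ ustar S t i k| ≤ B

end Contract

section Step

variable {P : TubeSchedule} {Bcl : ℕ → (Fin 2 → ℤ → ℝ) → Prop} {𝕊 : Finset (ℤ × ℤ × ℤ)} {σ ε₀ : ℝ} {i₀ : Fin 2}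
  {α : Fin 2 → Fin 2 → Fin 2 → ℤ × ℤ × ℤ → ℝ} {X₀ : Fin 2 → ℝ} {w : ℤ → ℝ} {r θ₀ c₀ t₀ : ℝ}
  {ζ : ℕ → Fin 2 → ℤ → ℝ} {ustar : Fin 2 → ℤ → ℝ} {good : ℕ → (Fin 2 → ℤ → ℝ → ℝ) → ℝ → Prop} {n : ℕ}
  {W : Fin 2 → ℤ → ℝ → ℝ}

/-- The recentred state's core deviation is the anchored deviation divided by the ratio (exact algebra).
[cite: Tao2016AveragedNS, §6.4 (re-centring); cell LADDER §62] -/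
theorem coreDev_recentre (P : TubeSchedule) (i₀ : Fin 2) (ustar : Fin 2 → ℤ → ℝ) (S : Fin 2 → ℤ → ℝ → ℝ)
    {t a : ℝ} (ha : 0 < a) (i : Fin 2) (k : ℤ) :
    recentre S t a i k - anchorScale P i₀ (recentre S t a) * ustar i k = anchoredDev P i₀ ustar S t i k / a := by
  unfold recentre anchorScale anchoredDev
  dsimp only
  rw [add_zero, abs_div, abs_of_pos ha]
  ring

/-- **CONTRACT ⇒ CORE STEP.** The core landing contract at hop `n` with levels `lev` and total `B`, the interface levels on every
premise flow (the loop's certified data), a positive lower bound `AFL` of the clamped ratio at every good time, and the schedule row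
`B ≤ AFL · δ(n+1)` give the CORE zone obligation of the parametric tube for the choice rule.
[cite: Tao2016AveragedNS, §6.3–6.4 (statement shape of the checkpoint step); cell LADDER §62 (P-62a), referee W-28] -/
theorem tubeStepCoreWith_of_landing {lev : Fin 2 → ℝ} {B AFL : ℝ}
    (hex : ∀ z S₀ τ S F, HopPremiseWith P Bcl 𝕊 ε₀ i₀ α X₀ w r c₀ ζ ustar n z S₀ τ S F → ∃ t, good n S t)
    (hland : CoreLandingWith P Bcl 𝕊 ε₀ i₀ α X₀ w r c₀ ζ ustar good W n lev B)
    (hlev : ∀ z S₀ τ S F, HopPremiseWith P Bcl 𝕊 ε₀ i₀ α X₀ w r c₀ ζ ustar n z S₀ τ S F → ∀ t, good n S t →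
      ∀ s ∈ Icc 0 t, ∀ i, |(S - W) i (1 - (P.K : ℤ)) s| ≤ lev i)
    (hAFL : 0 < AFL)
    (hratio : ∀ z S₀ τ S F, HopPremiseWith P Bcl 𝕊 ε₀ i₀ α X₀ w r c₀ ζ ustar n z S₀ τ S F → ∀ t, good n S t →
      AFL ≤ clampedRatio P i₀ ε₀ θ₀ t S)
    (hδ : 0 ≤ P.δ (n + 1)) (hsched : B ≤ AFL * P.δ (n + 1)) :
    TubeStepCoreWith P Bcl (choiceRule P i₀ ε₀ θ₀ t₀ good) 𝕊 ε₀ i₀ α X₀ w r c₀ ζ ustar n := by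
  refine tubeStepCoreWith_of_good hex ?_
  intro z S₀ τ S F hprem t ht i k hk
  have ha : 0 < clampedRatio P i₀ ε₀ θ₀ t S := lt_of_lt_of_le hAFL (hratio z S₀ τ S F hprem t ht)
  have hB : geomGauge P.g P.b i k * |anchoredDev P i₀ ustar S t i k| ≤ B :=
    hland z S₀ τ S F hprem t ht (hlev z S₀ τ S F hprem t ht) i k hk
  have hBa : B ≤ clampedRatio P i₀ ε₀ θ₀ t S * P.δ (n + 1) :=
    hsched.trans (mul_le_mul_of_nonneg_right (hratio z S₀ τ S F hprem t ht) hδ)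
  rw [coreDev_recentre P i₀ ustar S ha, abs_div, abs_of_pos ha, ← mul_div_assoc, div_le_iff₀ ha]
  calc geomGauge P.g P.b i k * |anchoredDev P i₀ ustar S t i k| ≤ B := hB
    _ ≤ clampedRatio P i₀ ε₀ θ₀ t S * P.δ (n + 1) := hBa
    _ = P.δ (n + 1) * clampedRatio P i₀ ε₀ θ₀ t S := mul_comm _ _

/-- **CONTRACT ⇒ CORE STEP, P-62a row shape.** The same with the total `B` in the `LandingLevel` shape, so that the schedule hypothesis is
literally the certificate conjunct `hcoreland` (+ kick allowance `KI`, + reference defect `DJ`, ratio floor `AFL`).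
[cite: Tao2016AveragedNS, §6.4 (statement shape); cell LADDER §62 (P-62a), DEFECT-62] -/
theorem tubeStepCoreWith_of_landing_row {lev KF : Fin 2 → ℝ} {RHOC KQ DJ KI AFL : ℝ}
    (hex : ∀ z S₀ τ S F, HopPremiseWith P Bcl 𝕊 ε₀ i₀ α X₀ w r c₀ ζ ustar n z S₀ τ S F → ∃ t, good n S t)
    (hland : CoreLandingWith P Bcl 𝕊 ε₀ i₀ α X₀ w r c₀ ζ ustar good W n lev
      (LandingLevel RHOC KQ DJ KI (P.δ n) KF lev))
    (hlev : ∀ z S₀ τ S F, HopPremiseWith P Bcl 𝕊 ε₀ i₀ α X₀ w r c₀ ζ ustar n z S₀ τ S F → ∀ t, good n S t →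
      ∀ s ∈ Icc 0 t, ∀ i, |(S - W) i (1 - (P.K : ℤ)) s| ≤ lev i)
    (hAFL : 0 < AFL)
    (hratio : ∀ z S₀ τ S F, HopPremiseWith P Bcl 𝕊 ε₀ i₀ α X₀ w r c₀ ζ ustar n z S₀ τ S F → ∀ t, good n S t →
      AFL ≤ clampedRatio P i₀ ε₀ θ₀ t S)
    (hδ : 0 ≤ P.δ (n + 1))
    (hcoreland : RHOC * (P.δ n + KI) + (KF 0 * lev 0 + KF 1 * lev 1) + KQ * (P.δ n + KI) ^ 2 + DJ ≤ AFL * P.δ (n + 1)) :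
    TubeStepCoreWith P Bcl (choiceRule P i₀ ε₀ θ₀ t₀ good) 𝕊 ε₀ i₀ α X₀ w r c₀ ζ ustar n :=
  tubeStepCoreWith_of_landing hex hland hlev hAFL hratio hδ (by simpa [LandingLevel] using hcoreland)

/-- **The kick allowance.** If the contraction gauge is dominated by the tube weight on the core half-line, `ω ≤ KIW · w` on `k ≥ −K`,
then the premise's kick ball `w k · |S₀ i k − z i k| ≤ r` has core-gauge size at most `KIW · r` (so `KI := KIW · r` in `LandingLevel`).
[cite: Tao2016AveragedNS, §6.2 (weighted kick ball, statement shape); cell LADDER §62] -/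
theorem kick_core_le (P : TubeSchedule) {w : ℤ → ℝ} {r KIW : ℝ} {S₀ z : Fin 2 → ℤ → ℝ}
    (hKIW : 0 ≤ KIW) (hwg : ∀ (i : Fin 2) (k : ℤ), -(P.K : ℤ) ≤ k → geomGauge P.g P.b i k ≤ KIW * w k)
    (hkick : ∀ i k, w k * |S₀ i k - z i k| ≤ r) :
    ∀ (i : Fin 2) (k : ℤ), -(P.K : ℤ) ≤ k → geomGauge P.g P.b i k * |S₀ i k - z i k| ≤ KIW * r := by
  intro i k hk
  calc geomGauge P.g P.b i k * |S₀ i k - z i k| ≤ KIW * w k * |S₀ i k - z i k| :=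
        mul_le_mul_of_nonneg_right (hwg i k hk) (abs_nonneg _)
    _ = KIW * (w k * |S₀ i k - z i k|) := by ring
    _ ≤ KIW * r := mul_le_mul_of_nonneg_left (hkick i k) hKIW

/-- **A rational ratio floor (Bernoulli).** `1 − θ₀ε₀ ≤ (1+ε₀)^(−θ₀)` for `0 ≤ ε₀`, `0 ≤ θ₀ ≤ 1`; hence `AFL := 1 − θ₀ε₀` is an admissible
(exact rational) lower bound of the clamped ratio in `tubeStepCoreWith_of_landing` (desk: `99975/100000` at `θ₀ = 1/4`, `ε₀ = 10⁻³`).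
[cite: Tao2016AveragedNS, §6.4 Prop. 6.5 (ratio floor, statement shape); folklore (Bernoulli)] -/
theorem one_sub_mul_le_rpow_neg {ε₀ θ₀ : ℝ} (hε : 0 ≤ ε₀) (hθ0 : 0 ≤ θ₀) (hθ1 : θ₀ ≤ 1) :
    1 - θ₀ * ε₀ ≤ (1 + ε₀) ^ (-θ₀) := by
  have h1 : 0 < 1 + ε₀ := by linarith
  have hup : (1 + ε₀) ^ θ₀ ≤ 1 + θ₀ * ε₀ := rpow_one_add_le_one_add_mul_self (by linarith) hθ0 hθ1
  have hpos : 0 < (1 + ε₀) ^ θ₀ := Real.rpow_pos_of_pos h1 θ₀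
  rw [Real.rpow_neg h1.le, ← one_div, le_div_iff₀ hpos]
  rcases le_or_gt (1 - θ₀ * ε₀) 0 with hneg | hposa
  · calc (1 - θ₀ * ε₀) * (1 + ε₀) ^ θ₀ ≤ 0 := mul_nonpos_of_nonpos_of_nonneg hneg hpos.le
      _ ≤ 1 := zero_le_one
  · calc (1 - θ₀ * ε₀) * (1 + ε₀) ^ θ₀ ≤ (1 - θ₀ * ε₀) * (1 + θ₀ * ε₀) := mul_le_mul_of_nonneg_left hup hposa.le
      _ = 1 - (θ₀ * ε₀) ^ 2 := by ring
      _ ≤ 1 := by nlinarith [sq_nonneg (θ₀ * ε₀)]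

/-- The Bernoulli floor is below the clamped ratio at every time: the `hratio` input of `tubeStepCoreWith_of_landing` with
`AFL := 1 − θ₀ε₀`, unconditionally in the flow. [cite: Tao2016AveragedNS, §6.4 Prop. 6.5 (ratio floor); cell LADDER §62] -/
theorem one_sub_mul_le_clampedRatio (P : TubeSchedule) (i₀ : Fin 2) {ε₀ θ₀ : ℝ} (hε : 0 ≤ ε₀) (hθ0 : 0 ≤ θ₀) (hθ1 : θ₀ ≤ 1)
    (t : ℝ) (S : Fin 2 → ℤ → ℝ → ℝ) : 1 - θ₀ * ε₀ ≤ clampedRatio P i₀ ε₀ θ₀ t S :=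
  (one_sub_mul_le_rpow_neg hε hθ0 hθ1).trans (floor_le_clampedRatio P i₀ ε₀ θ₀ t S)

end Step

/-! ## Window + tail: the finite-window reduction of the contract (referee A-115 (ii), core zone)

The certificate encloses the anchored one-hop map on the FINITE window `k ∈ [−K, k_A]`; beyond `k_A` the core clause is carried by
(T1) a gauge tail bound of the flow at good times (the AHEAD zone's along-the-flow a-priori bound, `TailThin`-type) and (T2) the gauge tail
of the reference profile `u⋆` times the head-carrier ratio.  The reduction is the triangle inequality; it fixes the SHAPE of the two tail
inputs so that no all-`k` enclosure is ever asked of the certificate. -/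

section WindowTail

variable (P : TubeSchedule) (Bcl : ℕ → (Fin 2 → ℤ → ℝ) → Prop) (𝕊 : Finset (ℤ × ℤ × ℤ)) (ε₀ : ℝ) (i₀ : Fin 2)
  (α : Fin 2 → Fin 2 → Fin 2 → ℤ × ℤ × ℤ → ℝ) (X₀ : Fin 2 → ℝ) (w : ℤ → ℝ) (r c₀ : ℝ)
  (ζ : ℕ → Fin 2 → ℤ → ℝ) (ustar : Fin 2 → ℤ → ℝ) (good : ℕ → (Fin 2 → ℤ → ℝ → ℝ) → ℝ → Prop)
  (W : Fin 2 → ℤ → ℝ → ℝ)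

/-- The contract restricted to the finite window `−K ≤ k ≤ k_A` (what the interval certificate encloses).
[cite: Tao2016AveragedNS, §6.3–6.4 (statement shape); cell LADDER §62 (P-62a), referee A-115] -/
def CoreLandingWindowWith (n : ℕ) (lev : Fin 2 → ℝ) (B : ℝ) (kA : ℤ) : Prop :=
  ∀ z S₀ τ S F, HopPremiseWith P Bcl 𝕊 ε₀ i₀ α X₀ w r c₀ ζ ustar n z S₀ τ S F → ∀ t, good n S t →
    (∀ s ∈ Icc 0 t, ∀ i, |(S - W) i (1 - (P.K : ℤ)) s| ≤ lev i) →
      ∀ (i : Fin 2) (k : ℤ), -(P.K : ℤ) ≤ k → k ≤ kA →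
        geomGauge P.g P.b i k * |anchoredDev P i₀ ustar S t i k| ≤ B

/-- (T1) The flow's gauge tail beyond the window at good times (an AHEAD-zone a-priori bound along the flow, one shell up).
[cite: Tao2016AveragedNS, §6.2 Prop. 6.3 (ix) (thin tails, statement shape); cell LADDER §50 (TailThin hand-over), referee A-115 (ii)] -/
def AheadTailWith (n : ℕ) (kA : ℤ) (BT : ℝ) : Prop :=
  ∀ z S₀ τ S F, HopPremiseWith P Bcl 𝕊 ε₀ i₀ α X₀ w r c₀ ζ ustar n z S₀ τ S F → ∀ t, good n S t →
    ∀ (i : Fin 2) (k : ℤ), kA < k → geomGauge P.g P.b i k * |S i (1 + k) t| ≤ BT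

end WindowTail

section WindowTailStep

variable {P : TubeSchedule} {Bcl : ℕ → (Fin 2 → ℤ → ℝ) → Prop} {𝕊 : Finset (ℤ × ℤ × ℤ)} {ε₀ : ℝ} {i₀ : Fin 2}
  {α : Fin 2 → Fin 2 → Fin 2 → ℤ × ℤ × ℤ → ℝ} {X₀ : Fin 2 → ℝ} {w : ℤ → ℝ} {r c₀ : ℝ}
  {ζ : ℕ → Fin 2 → ℤ → ℝ} {ustar : Fin 2 → ℤ → ℝ} {good : ℕ → (Fin 2 → ℤ → ℝ → ℝ) → ℝ → Prop} {n : ℕ}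
  {W : Fin 2 → ℤ → ℝ → ℝ}

/-- **WINDOW + TAIL ⇒ CONTRACT.** The finite-window landing, the flow's gauge tail `BT` beyond the window at good times, a head bound
`|S i₀ 1 t| ≤ MH` at good times and the reference profile's gauge tail `UT` beyond the window give the full contract with any
`B ≥ max(B_w, BT + (MH/A_*)·UT)`.
[cite: Tao2016AveragedNS, §6.3–6.4 (statement shape); cell LADDER §62, referee A-115 (ii)] -/
theorem coreLandingWith_of_window_tail {lev : Fin 2 → ℝ} {Bw B BT MH UT : ℝ} {kA : ℤ}
    (hg : 0 < P.g) (hb : 0 < P.b) (hA : 0 < P.Astar)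
    (hwin : CoreLandingWindowWith P Bcl 𝕊 ε₀ i₀ α X₀ w r c₀ ζ ustar good W n lev Bw kA)
    (htail : AheadTailWith P Bcl 𝕊 ε₀ i₀ α X₀ w r c₀ ζ ustar good n kA BT)
    (hhead : ∀ z S₀ τ S F, HopPremiseWith P Bcl 𝕊 ε₀ i₀ α X₀ w r c₀ ζ ustar n z S₀ τ S F → ∀ t, good n S t →
      |S i₀ 1 t| ≤ MH)
    (hU : ∀ (i : Fin 2) (k : ℤ), kA < k → geomGauge P.g P.b i k * |ustar i k| ≤ UT)
    (hBw : Bw ≤ B) (hBT : BT + MH / P.Astar * UT ≤ B) :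
    CoreLandingWith P Bcl 𝕊 ε₀ i₀ α X₀ w r c₀ ζ ustar good W n lev B := by
  intro z S₀ τ S F hprem t ht hlev i k hk
  rcases le_or_gt k kA with hkA | hkA
  · exact (hwin z S₀ τ S F hprem t ht hlev i k hk hkA).trans hBw
  · have hω : 0 ≤ geomGauge P.g P.b i k := (geomGauge_pos hg hb i k).le
    have h1 : geomGauge P.g P.b i k * |S i (1 + k) t| ≤ BT := htail z S₀ τ S F hprem t ht i k hkA
    have h2 : geomGauge P.g P.b i k * |ustar i k| ≤ UT := hU i k hkA
    have h3 : |S i₀ 1 t| / P.Astar ≤ MH / P.Astar :=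
      div_le_div_of_nonneg_right (hhead z S₀ τ S F hprem t ht) hA.le
    have h4 : 0 ≤ |S i₀ 1 t| / P.Astar := div_nonneg (abs_nonneg _) hA.le
    have htri : |anchoredDev P i₀ ustar S t i k| ≤ |S i (1 + k) t| + |S i₀ 1 t| / P.Astar * |ustar i k| := by
      unfold anchoredDev
      calc |S i (1 + k) t - |S i₀ 1 t| / P.Astar * ustar i k|
          ≤ |S i (1 + k) t| + |(|S i₀ 1 t| / P.Astar) * ustar i k| := abs_sub _ _
        _ = |S i (1 + k) t| + |S i₀ 1 t| / P.Astar * |ustar i k| := by rw [abs_mul, abs_of_nonneg h4]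
    calc geomGauge P.g P.b i k * |anchoredDev P i₀ ustar S t i k|
        ≤ geomGauge P.g P.b i k * (|S i (1 + k) t| + |S i₀ 1 t| / P.Astar * |ustar i k|) :=
          mul_le_mul_of_nonneg_left htri hω
      _ = geomGauge P.g P.b i k * |S i (1 + k) t| + |S i₀ 1 t| / P.Astar * (geomGauge P.g P.b i k * |ustar i k|) := by ring
      _ ≤ BT + MH / P.Astar * UT := add_le_add h1 (mul_le_mul h3 h2 (mul_nonneg hω (abs_nonneg _)) (div_nonneg (le_trans (abs_nonneg _) (hhead z S₀ τ S F hprem t ht)) hA.le))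
      _ ≤ B := hBT

end WindowTailStep

/-! ## Monotonicity of the landing level (dictionary use: inner levels `lev ≤ lev'` with nonnegative forcing constants) -/

section LevelMono

/-- **The P-62a landing level is monotone in the interface levels** when the interface forcing constants are nonnegative
(`0 ≤ KF i`): a row certified with inner levels `lev' ≥ lev` (the certificate's `RBARA ≥ RBAR`, `BBARA ≥ BBAR`) also bounds the
level at `lev`. [folklore (monotonicity of a polynomial with nonnegative coefficients); cell LADDER §61 (inner levels `hapri`), §62 (P-62a)] -/
theorem landingLevel_mono_lev {RHOC KQ DJ KI δn : ℝ} {KF lev lev' : Fin 2 → ℝ} (hKF : ∀ i, 0 ≤ KF i)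
    (hle : ∀ i, lev i ≤ lev' i) :
    LandingLevel RHOC KQ DJ KI δn KF lev ≤ LandingLevel RHOC KQ DJ KI δn KF lev' := by
  unfold LandingLevel
  have h0 := mul_le_mul_of_nonneg_left (hle 0) (hKF 0)
  have h1 := mul_le_mul_of_nonneg_left (hle 1) (hKF 1)
  linarith

end LevelMono

end Summit.NavierStokesRegularity.NavierStokesRegularity.Theorems.HopTube
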